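import Summits.AnomalousDissipation.AnomalousDissipation.Theses.TaylorCertificates
import Summits.AnomalousDissipation.AnomalousDissipation.Theorems.FloorCertificate.Negative.WeakDuality
import Summits.AnomalousDissipation.AnomalousDissipation.Theorems.FloorCertificate.Negative.Uniform
import Literature.Analysis.FluidPDE.StatisticalSolution
import Literature.Analysis.FluidPDE.StokesTorusProofs
import Literature.Analysis.FluidPDE.EnergySpaceTorusHilbertBasisProofs

/-!
# Line `marchioro-force-floor` for crux `TaylorCertificates.FloorCertificate`
# (stmt-AnomalousDissipation-14091) — checked skeleton (crux-plan, round 1, 2026-08-16)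

Idea card: `Cruxes/FloorCertificate/Ideas/marchioro-force-floor.md` (ideator 2; triage r1-1 / r1-2 / r1-3:
pass ×3, with the instruction to COMPOSE it with the merged minimax line
`dissipation-tight-minimax ≈ floor-minimax-dissipation-tightness ≈ dissipation-deficit-duality`).
Line card: `Lines/marchioro-force-floor.md`.

THE LINE. The crux asks for ONE smooth solenoidal mean-zero force `f` on `T³` and `ε₀, ν₀ > 0` such
that at every `ν < ν₀` some energy–cylindrical multiplier `(Φ₁, θ₁ ≤ 0)` certifies
`ε₀ ≤ ν‖∇u‖² + ⟨F_ν(u), Φ₁'(u)⟩ + 2θ₁((u,f) − ν‖∇u‖²)` at every finite-enstrophy state of the Leray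
ball `|u|² ≤ 16‖f‖²/ν²`. PIN THE FORCE to the gravest Kolmogorov mode
`f_K = sin(2πx₁) e₀ = Torus.stokesMode e₁ e₀ (sin)` — admissible because the crux is FLOOR-only
(the Marchioro barrier kills CEILINGS for single-shell forces; a fat LOUD laminar state is harmless
to a floor) — and go to the DUAL side, where the force's eigenfield structure acts:
* (S1, analysis) FLOOR MINIMAX: at fixed `ν` the best certifiable floor on a ball equals the least
  mean dissipation over the RELAXED stationary statistics on that ball (probability measures on `H`
  carried by the ball, finite mean enstrophy, cylindrical Liouville identity, ONE global mean energy
  inequality) — so a certificate with floor `ε` exists as soon as every relaxed statistic dissipates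
  `≥ ε + δ`. (The converse, weak duality, is LANDED: `Negative.WeakDuality`.)
* (S2, the Marchioro engine, provable now) WORK BOUND FOR EIGENFIELD FORCING: for a force with
  `Δf = −λf`, testing the Liouville identity with the work functional `u ↦ (u,f)` gives
  `‖f‖² + ∫ I_f dμ = νλ ∫ (u,f) dμ` (`I_f(u) = ∫(u⊗u):∇f`, the Reynolds stress against the forcing
  shear), and Poincaré IN THE DIRECTION OF `f` (`λ(u,f)² ≤ ‖f‖²‖∇u‖²`) turns the right-hand side into
  `≤ ‖f‖ (νλ ε(μ))^{1/2}`: every statistic dissipating `o(1/ν)` is ANTI-PUMPING, `∫ I_f dμ → −‖f‖²`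
  — it must hold the force entirely by cross-shell Reynolds stress (the laminar Dirac, every
  first-shell statistic and every 2½-D sector statistic are thereby excluded from the enemy set:
  they are pumping-neutral and hyper-loud).
* (S3, physics, THE CRUX OF THE LINE) NO QUIET HONEST STATISTICS OF CUBE KOLMOGOROV FLOW: an
  anti-pumping relaxed statistic of `NS_ν(f_K)` whose energy leak `∫((u,f) − ν‖∇u‖²) dμ` is small
  dissipates `≥ ε₁`, uniformly in `ν < ν₁` (forbids quiet steady states, quiet periodic orbits /
  tori / SSP states, quiet turbulent branches of cube Kolmogorov flow — none is known; every charted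
  invariant object is loud in fixed-force units).
* (S4, fixed-`ν` energy budget, open) QUIET STATISTICS LEAK LITTLE: a relaxed statistic of
  `NS_ν(f_K)` with small viscous dissipation has small anomalous leak `∫(u,f)dμ − ε(μ)` (believed:
  no anomalous dissipation at positive viscosity; FMRT IV (1.31) is only an inequality in 3-D, so it
  is a genuine stub, separated from S3 because its enemy — sustained singular dissipation at fixed
  `ν` — is a different animal from S3's dodging statistics).
Composition (kernel-checked, no `sorry` outside the four `stub_*`): S2 + S3 + S4 ⇒
`kolmogorov_relaxed_loud` (every relaxed statistic of `f_K` on the Leray ball dissipates `≥ ε⋆`,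
`ν < ν⋆`) ⇒ (S1 with `ε = δ = ε⋆/2`) `kolmogorovForceFloor` (the card's TRANSFER TARGET `C⁺`: the
crux with `f` instantiated at `f_K`) ⇒ `FloorCertificate_of : TaylorCertificates.FloorCertificate`
BY NAME (regularity of the Stokes mode from the tree: `isSmooth_stokesMode`, `isDivFree_stokesMode`,
`hasZeroMean_stokesMode`, `laplacian_stokesMode`, `stokesEigenvalue_pos`).

STUBS are stated over TREE VOCABULARY ONLY (no local definition or notation enters a stub), so that
each can be landed verbatim as `Theorems/FloorCertificate/<Stub>.lean --supports
stmt-AnomalousDissipation-14091`; copy the `open` lines below. `u.1` is the `L²` class of a state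
`u ∈ H = Torus.energySpace (Fin 3)`. The RELAXED CLASS on the ball of squared radius `ρ` is spelled
identically in S1–S4: `IsProbabilityMeasure μ`, `∀ᵐ u ∂μ, ‖u‖² ≤ ρ`, `Torus.ensembleEnstrophy μ < ⊤`,
cylindrical Liouville with integrability, integrability of `u ↦ (u,f)`, and
`∫ (ν‖∇u‖² − (u,f)) dμ ≤ 0`.

DISPROOF USED (`Cruxes/FloorCertificate/Disproof.lean`, cdisprove v2, 0 sorry; its landed copies
`Theorems/FloorCertificate/Negative/{WeakDuality,UniformTools,Uniform}.lean` are IMPORTED above, so every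
stub is checked in their presence; the file has no `_false_without_` theorem):
* §C `floorFamily_le_ensembleDissipation` / `floorFamily_le_dissipation_of_steady` (weak duality) — this
  line is its converse direction plus loudness: S1 closes the duality gap, S3/S4 supply loudness; the
  negative lemmas `floorCertificate_false_of_quietStatistics/_of_quietSteadyStates` name exactly the
  negation of S3 ⊕ S4 restricted to `f_K` (a quiet stationary statistic / quiet steady state of cube
  Kolmogorov flow kills THIS LINE, not the `∃ f` crux).
* §B `floor_at_rest` (`ε₀ ≤ (f, Φ₁'(0))`) — automatic for a minimax certificate (S1 output); §D
  `floor_at_quiet_euler_point` (1/ν coercivity at smooth quiet Euler points: `f_K` has 2½-D cellular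
  dodgers) — honoured on the dual side: a quiet EULER point `v` is not a relaxed statistic at `ν > 0`
  (`∫Φ̇ dδ_v = −ν(∇v, ∇Φ'(v)) ≠ 0`), only EXACT quiet stationary statistics of `NS_ν(f_K)` bear on S3,
  and S1's `Φ₁` is `ν`-dependent with unbounded `|θ₁|`, as §D demands.
* §E `not_floorCertificateUniform` (refuted strengthening: no `ν`-independent certificate for any
  force) — respected: S1 produces `(Φ₁, θ₁)` at each `ν` separately; nothing uniform is claimed.
`ledger negatives --problem AnomalousDissipation` (13037 TaylorCertificatePair ceiling, 2979/2984
FrustratedForces drift data, 2859 DebrisQuanta): none is a floor statement; no stub is an instance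
(all states here live in mean-zero `H`; no ceiling is claimed — `EnsembleCeiling(f_K)` is FALSE,
`Theorems/EnsembleCeiling/Negative/SingleModeFat`, and this line closes item #5 only, as the card and
all three triagers record).
-/

namespace Summit.AnomalousDissipation.AnomalousDissipation.Cruxes.FloorCertificate.MarchioroForceFloor

open MeasureTheory Filter Topology
open scoped ENNReal NNReal InnerProductSpace RealInnerProductSpace
open Literature.Analysis.FunctionSpaces Literature.Analysis.FluidPDE

set_option linter.dupNamespace false

noncomputable section

/-! ## S1 — the floor minimax (strong duality for floors on a ball): analysis, size L -/

/-- **S1 `stub_floorMinimax` — strong duality for the FLOOR on a ball.** Fix `ν > 0`, a radius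
`ρ ≥ 0`, a smooth force `f`, a level `ε` and a margin `δ > 0`. If every RELAXED stationary statistic
of `NS_ν(f)` on the ball `{‖u‖² ≤ ρ}` — a Borel probability measure `μ` on `H` carried by the ball,
of finite mean enstrophy, annihilating the cylindrical Liouville functionals
(`∫ ⟨F_ν(u), Φ'(u)⟩ dμ = 0` for every `Φ : Torus.CylindricalTest`, integrand integrable), with
`u ↦ (u,f)` integrable and the ONE global mean energy inequality `∫ (ν‖∇u‖² − (u,f)) dμ ≤ 0` — has
mean dissipation `ε(μ) = ν∫‖∇u‖²dμ ≥ ε + δ`, then some cylindrical `Φ₁` and weight `θ₁ ≤ 0` certify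
the floor `ε` pointwise: `ε ≤ D + ⟨F_ν(u),Φ₁'(u)⟩ + 2θ₁((u,f) − D)`, `D = ν‖∇u‖²`, at every
finite-enstrophy `u ∈ H` with `‖u‖² ≤ ρ` (verbatim the inner clause of the crux, with the radius as a
parameter). WHY TRUE (paper proof = cards `floor-minimax-dissipation-tightness` §Mechanism (i)–(v) /
`dissipation-tight-minimax`, re-derived independently by all three triagers, TRIAGE-r1-2 §"structural
fact", r1-3 (X1)): the Lagrangian `L_{Φ,θ}(u) = (1−2θ)D + Φ̇(u) + 2θ(u,f)` is lower semicontinuous and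
bounded below on the ball in the NORM topology of `H` (`D` lsc and `= +∞` off `V`; the generator
pairing `u ↦ Torus.nsGeneratorPairing ν f u (Φ.grad u)` is norm-continuous and bounded on the ball
INDEPENDENTLY of the enstrophy — only the test field is differentiated — `GeneratorBoundOnBall`);
`μ ↦ ∫L dμ` is narrowly lsc and affine; the dissipation sublevel sets `{μ ∈ P(ball) : ∫D dμ ≤ c}` are
tight (Markov + Rellich: `{‖u‖² ≤ ρ, ‖∇u‖² ≤ t}` is `H`-compact) hence narrowly compact (Prokhorov,
Mathlib `isCompact_closure_of_isTightMeasureSet`; tree `isTightMeasureSet_of_lintegral_le`,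
`Literature/Probability/Process/KrylovBogoliubov.lean`) and closed (portmanteau); the multiplier
class is convex ON THE BALL (sums `φ_a(x) + φ_b(y)` re-cut-off by a `C¹_c` bump ≡ 1 on the bounded
coordinate box of the ball, gradients unchanged there) and closed under `Φ ↦ λΦ`; a LOPSIDED minimax
(Kneser–Fan on `X × conv{y₀,…,y_k}` with the compact side the finite simplex, `y₀ = (0,0)`
inf-compact, plus the finite-intersection property; Aubin, Optima and Equilibria, Thm 8.1 / Prop 8.3)
gives `sup_{Φ,θ} inf_u L = min_μ sup_{Φ,θ} ∫L dμ`; the right-hand sup is `+∞` unless `μ` is relaxed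
stationary, where it equals `∫D dμ ≥ ε + δ`; Diracs at finite-enstrophy ball states evaluate the
left-hand inf, and the margin `δ` absorbs non-attainment of the sup. LEAD'S FIRST RESHAPE
(foreseen, TRIAGE-r1-2 sharpen (1)): s1 `GeneratorBoundOnBall` + norm-continuity of the generator
pairing (M) · s2 lsc / compact sublevels of `eGradNormSq` on the ball (M, Rellich in tree) · s3
tightness ⇒ narrow compactness + closedness of `{∫D ≤ c}` (M) · s4 an ABSTRACT lopsided minimax
over Mathlib (L; none in Mathlib — Kneser–Fan via `geometric_hahn_banach_open`; shareable with
AtomisticToContinuum's sorried `CorrectorMinimax`) · s5 evaluation of both sides (M).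
Sources: arXiv:2010.06730 Thms 6.2–6.4, Rem 6.1–6.2 (Rosa–Temam: weak duality in 3-D; the gap is
closed here because only `(1−2θ)D + Φ̇` needs semicontinuity and `D` is coercive);
TobascoGoluskinDoering2018 (finite-dimensional shadow, tree `TobascoGoluskinDoering2018_measureForm`);
FoiasManleyRosaTemam2001 IV §1. Size L. -/
theorem stub_floorMinimax :
    ∀ (ν ρ ε δ : ℝ) (f : UnitAddTorus (Fin 3) → EuclideanSpace ℝ (Fin 3)),
      0 < ν → 0 ≤ ρ → 0 < δ → Torus.IsSmooth f →
      (∀ μ : Measure (Torus.energySpace (Fin 3)),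
        IsProbabilityMeasure μ →
        (∀ᵐ u ∂μ, ‖u‖ ^ 2 ≤ ρ) →
        Torus.ensembleEnstrophy μ < ⊤ →
        (∀ Φ : Torus.CylindricalTest (Fin 3),
          Integrable (fun u => Torus.nsGeneratorPairing ν f u (Φ.grad u)) μ ∧
            ∫ u, Torus.nsGeneratorPairing ν f u (Φ.grad u) ∂μ = 0) →
        Integrable (fun u : Torus.energySpace (Fin 3) => Torus.pairing u.1 f) μ →
        ∫ u, (ν * (Torus.eGradNormSq u.1).toReal - Torus.pairing u.1 f) ∂μ ≤ 0 →
        ε + δ ≤ Torus.ensembleDissipation ν μ) →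
      ∃ (Φ₁ : Torus.CylindricalTest (Fin 3)) (θ₁ : ℝ), θ₁ ≤ 0 ∧
        ∀ u : Torus.energySpace (Fin 3),
          Torus.eGradNormSq u.1 ≠ ⊤ → ‖u‖ ^ 2 ≤ ρ →
            ε ≤ ν * (Torus.eGradNormSq u.1).toReal + Torus.nsGeneratorPairing ν f u (Φ₁.grad u) +
              2 * θ₁ * (Torus.pairing u.1 f - ν * (Torus.eGradNormSq u.1).toReal) := by
  sorry

/-! ## S2 — the work bound for Stokes-eigenfield forcing (the Marchioro engine): size M -/

/-- **S2 `stub_eigenforceWorkBound` — anti-pumping of sub-laminar statistics under eigenfield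
forcing.** Let `f` be a smooth solenoidal mean-zero STOKES EIGENFIELD, `Δf = −λf` with `λ > 0`
(every single-shell force; the Kolmogorov force `sin(2πx₁)e₀` has `λ = 4π²`), `ν > 0`, and let `μ`
be a probability measure on `H` carried by a ball, of finite mean enstrophy, annihilating the
cylindrical Liouville functionals of `NS_ν(f)`, with `u ↦ (u,f)` integrable (no energy inequality is
needed). Then the mean Reynolds stress against the forcing shear, `∫ I_f dμ` with
`I_f(u) = Torus.inertialPairing u f = ∫(u⊗u):∇f`, satisfies
`‖f‖² + ∫ I_f dμ ≤ ‖f‖ · (ν λ ε(μ))^{1/2}`, `ε(μ) = Torus.ensembleDissipation ν μ`. WHY TRUE (half a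
page): (W) WORK IDENTITY — the work functional `Φ_W(u) = ψ((u,f))`, `ψ(t) = t·χ(t)` with `χ` a `C¹_c`
bump `≡ 1` on `|t| ≤ ‖f‖√ρ` (Mathlib `ContDiffBump`), is a `Torus.CylindricalTest` with ONE coordinate
`g₀ = f` and `Φ_W'(u) = f` on the ball, so the Liouville identity at `Φ_W` reads
`∫ Torus.nsGeneratorPairing ν f u f dμ = 0`, and `⟨F_ν(u), f⟩ = (f,f) + ν(u,Δf) + I_f(u) =
‖f‖² − νλ(u,f) + I_f(u)` (`Torus.laplacian_stokesMode`-type hypothesis), i.e.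
`‖f‖² + ∫I_f dμ = νλ ∫(u,f) dμ`; (P) POINCARÉ IN THE DIRECTION OF `f` — for a finite-enstrophy state,
`(∇u, ∇f) = λ(u,f)` and `|(∇u,∇f)| ≤ ‖∇u‖ ‖∇f‖ = ‖∇u‖ (λ‖f‖²)^{1/2}`, so `λ(u,f)² ≤ ‖f‖² ‖∇u‖²`
(spectrally: `f` lives on the sphere `4π²|k|² = λ`; Parseval for `Torus.pairing` with a trigonometric
polynomial, `Torus.eGradNormSq = Σ 4π²|k|²|û(k)|²`); (J) Jensen — `(∫(u,f)dμ)² ≤ ∫(u,f)²dμ ≤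
‖f‖² (Torus.ensembleEnstrophy μ).toReal / λ`, hence `νλ∫(u,f)dμ ≤ (‖f‖²·νλ·ν∫‖∇u‖²dμ)^{1/2}`.
(If `ρ < 0` the hypotheses are contradictory; `∫(u,f)dμ < 0` only helps.) CONSEQUENCE used by the
composition: a statistic with `ε(μ) = o(1/ν)` has `∫I_f dμ → −‖f‖²` (ANTI-PUMPING); with the energy
inequality also `∫I_f dμ ≥ −‖f‖²`, so quiet statistics cancel the forcing by Reynolds stress
EXACTLY in the limit — the laminar Dirac (`I_f = 0`, `ε = ‖f‖²/(νλ)`), every first-shell-supported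
statistic (`I_f ≡ 0` on `E₁` by the 3-D first-shell closure, machine-checked lattice part in the
triager's `scratch/FirstShell.lean`) and every 2½-D sector statistic of `f_K` (Iudovich–Marchioro
laminar, TRIAGE-r1-3 (X2)) are pumping-neutral, hence outside the enemy set of S3.
Sources: Marchioro1986 (eigenmode forcing, `(f,−Δu) = λ(f,u)`), DoeringFoias2002 §2 (energy/work
budget), FoiasManleyRosaTemam2001 IV (1.30); tree `Torus.laplacian_stokesMode`,
`Torus.inner_stokesModeL2_left_of_ae_eq`, `Negative.WeakDuality.norm_toLp_sq`. Size M. -/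
theorem stub_eigenforceWorkBound :
    ∀ (ν lam ρ : ℝ) (f : UnitAddTorus (Fin 3) → EuclideanSpace ℝ (Fin 3)),
      0 < ν → 0 < lam → Torus.IsSmooth f → Torus.IsDivFree f → Torus.HasZeroMean f →
      (∀ x, Torus.laplacian f x = (-lam) • f x) →
      ∀ μ : Measure (Torus.energySpace (Fin 3)),
        IsProbabilityMeasure μ →
        (∀ᵐ u ∂μ, ‖u‖ ^ 2 ≤ ρ) →
        Torus.ensembleEnstrophy μ < ⊤ →
        (∀ Φ : Torus.CylindricalTest (Fin 3),
          Integrable (fun u => Torus.nsGeneratorPairing ν f u (Φ.grad u)) μ ∧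
            ∫ u, Torus.nsGeneratorPairing ν f u (Φ.grad u) ∂μ = 0) →
        Integrable (fun u : Torus.energySpace (Fin 3) => Torus.pairing u.1 f) μ →
        (∫ x, ‖f x‖ ^ 2) + ∫ u, Torus.inertialPairing u.1 f ∂μ ≤
          Real.sqrt ((∫ x, ‖f x‖ ^ 2) * (ν * lam * Torus.ensembleDissipation ν μ)) := by
  sorry

/-! ## S3 — no quiet honest statistics of cube Kolmogorov flow: THE CRUX OF THE LINE, size XL -/

/-- **S3 `stub_noQuietHonestKolmogorovStatistics` — the physics stub (K1 of the card, on its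
enemy).** For the gravest Kolmogorov force `f_K = sin(2πx₁)e₀ = Torus.stokesMode e₁ e₀ (sin)` on the
unit `T³` there are a floor `ε₁ > 0`, a viscosity threshold `ν₁ > 0`, an anti-pumping margin `c > 0`
and a leak tolerance `η > 0` such that, for every `ν ∈ (0, ν₁)`, every RELAXED stationary statistic
`μ` of `NS_ν(f_K)` on the Leray ball `‖u‖² ≤ 16‖f_K‖²/ν²` (the class of S1) which is
(a) ANTI-PUMPING, `‖f_K‖² + ∫ I_{f_K} dμ ≤ c` — its mean Reynolds stress `∫∫ 2π cos(2πx₁) u₀u₁` all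
but cancels the injection (automatic for every statistic dissipating `o(1/ν)`, S2), and
(b) NEARLY HONEST, `∫(u,f_K)dμ ≤ ε(μ) + η` — small anomalous leak in the mean energy budget (automatic
for quiet statistics by S4),
dissipates at least `ε₁`: `ε₁ ≤ Torus.ensembleDissipation ν μ`. Equivalently: at small `ν` cube
Kolmogorov flow carries NO stationary statistic that is simultaneously quiet (`ε(μ) < ε₁`), honest and
force-cancelling — no quiet steady state, periodic orbit, invariant torus, self-sustaining (SSP)
state or quiet turbulent branch in the Leray ball, and no quiet non-dynamical relaxed statistic
either. WHY IT MIGHT BE TRUE: every charted invariant object of cube Kolmogorov flow is LOUD in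
fixed-force units — the laminar state `f_K/(4π²ν)` (`ε = ‖f_K‖²/(4π²ν) → ∞`, linearly stable at every
`Re` on the cube: Meshalkin–Sinai + Squire, arXiv:1512.02570 §2.2), the van Veen–Goto equilibria and
their periodic orbits (born in a saddle-node at `Re = 142.5`, hugging the laminar state, ibid. §4),
and turbulence (Musacchio–Boffetta 2014 §3.1: friction factor `f₀ = 0.124`, i.e. `ε = O(F^{3/2}L^{1/2})`
bounded BELOW and above); by (a) the enemy must hold the force by cross-shell Reynolds stress alone
(first-shell closure: `I_f ≡ 0` on `E₁`), with `O(1)` energy (`|I_f(u)| ≤ π‖u‖²` gives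
`∫‖u‖²dμ ≥ (‖f_K‖² − c)/π`) yet `o(1)` enstrophy `× ν`; every 2½-D sector (translation-invariant
class `d = (a,0,b)`) carries only the laminar statistic (Iudovich–Marchioro on the rectangular
quotient tori, OkamotoShoji1993 Thm 3.1, TRIAGE-r1-3 (X2)), so the enemy is genuinely
three-dimensional; no quiet invariant object of cube Kolmogorov flow has ever been reported. WHY IT
MIGHT FAIL: a quiet self-sustaining 3-D state (cellular dodger + streamline-coboundary streamwise flow
+ weak 3-D fluctuations feeding the cells at `O(ν)` power), a quiet lower-branch continuation of the
van Veen–Goto equilibria / edge states as `Re → ∞` (the designated kit falsifier of the card: continue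
the lower branch to `Re ~ 10³` in FIXED-FORCE units and plot the energy input — an input `→ 0` branch
is a quiet honest Dirac statistic), or a warm sheltered shear skeleton on ≥ 2 unforced lattice lines
(every single line is void for `f_K` by (X2)) — any ONE such family along `ν_j → 0` refutes S3 and, by
the landed `Negative.WeakDuality.floorFamily_le_ensembleDissipation`, the pinned transfer target (not
the `∃ f` crux). Symmetry averaging (the statistic may be assumed homogeneous in `(x₀, x₂)` and invariant under
the point group of `f_K`: the relaxed class, (a), (b) and `ε(μ)` are convex and invariant) and the
Bauer reduction to extreme relaxed statistics are available to the prover and deliberately NOT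
pre-applied here. Sources: VeenGoto2016 = arXiv:1512.02570 §§2.2, 4; MusacchioBoffetta2014 §3.1;
Marchioro1986; OkamotoShoji1993 Thm 3.1; doi:10.1063/1.869185 (Waleffe SSP);
Literature.Barriers.AnomalousDissipation.Marchioro1986_globalAttraction (positive side);
Disproof.lean §C. Size XL (hardest stub). -/
theorem stub_noQuietHonestKolmogorovStatistics :
    ∀ f : UnitAddTorus (Fin 3) → EuclideanSpace ℝ (Fin 3),
      f = ⇑(Torus.stokesMode (Pi.single 1 1 : Fin 3 → ℤ) (EuclideanSpace.single (0 : Fin 3) (1 : ℝ)) false) →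
      ∃ (ε₁ ν₁ c η : ℝ), 0 < ε₁ ∧ 0 < ν₁ ∧ 0 < c ∧ 0 < η ∧
        ∀ ν : ℝ, 0 < ν → ν < ν₁ →
        ∀ μ : Measure (Torus.energySpace (Fin 3)),
          IsProbabilityMeasure μ →
          (∀ᵐ u ∂μ, ‖u‖ ^ 2 ≤ 16 * (∫ x, ‖f x‖ ^ 2) / ν ^ 2) →
          Torus.ensembleEnstrophy μ < ⊤ →
          (∀ Φ : Torus.CylindricalTest (Fin 3),
            Integrable (fun u => Torus.nsGeneratorPairing ν f u (Φ.grad u)) μ ∧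
              ∫ u, Torus.nsGeneratorPairing ν f u (Φ.grad u) ∂μ = 0) →
          Integrable (fun u : Torus.energySpace (Fin 3) => Torus.pairing u.1 f) μ →
          ∫ u, (ν * (Torus.eGradNormSq u.1).toReal - Torus.pairing u.1 f) ∂μ ≤ 0 →
          (∫ x, ‖f x‖ ^ 2) + ∫ u, Torus.inertialPairing u.1 f ∂μ ≤ c →
          ∫ u, Torus.pairing u.1 f ∂μ ≤ Torus.ensembleDissipation ν μ + η →
          ε₁ ≤ Torus.ensembleDissipation ν μ := by
  sorry

/-! ## S4 — quiet statistics leak little (fixed-`ν` energy budget of quiet statistics): open -/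

/-- **S4 `stub_quietKolmogorovStatisticsSmallLeak` — quiet statistics are nearly honest.** For
`f_K` as in S3 and every leak tolerance `η > 0` there are `ε₂, ν₂ > 0` such that for `ν ∈ (0, ν₂)`
every relaxed stationary statistic `μ` of `NS_ν(f_K)` on the Leray ball (class of S1) with viscous
dissipation `ε(μ) < ε₂` injects little: `∫(u,f_K)dμ ≤ ε(μ) + η` (its anomalous leak
`L(μ) = ∫(u,f_K)dμ − ε(μ) ≥ 0` is `≤ η`). A PRIORI (from S2's two ingredients) a quiet statistic only
has `∫(u,f_K)dμ ≤ ‖f_K‖(ε(μ)/(4π²ν))^{1/2}`: its mean laminar component `t = (u, f_K/‖f_K‖)` may be as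
large as `(ε/ν)^{1/2}` (far below the laminar `ν⁻¹`), injecting `‖f_K‖ t̄` that is NOT dissipated by
viscosity — S4 says such sustained ANOMALOUS dissipation at FIXED positive viscosity does not occur in
stationary statistics, at least not at `O(1)` rate when the viscous dissipation is small. WHY IT MIGHT
BE TRUE: it is the stationary-ensemble shadow of the energy EQUALITY for Navier–Stokes at `ν > 0`
(believed for all Leray–Hopf flows; every steady state satisfies it exactly — Temam's
`IsSteadyWeakSolution.energy_eq'`, PROVED in tree — so every finitely supported relaxed statistic has
zero leak; time-average measures of regular flows have zero leak); quietness even helps (small mean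
enstrophy `∫‖∇u‖²dμ = ε/ν`). WHY IT MIGHT FAIL / WHY IT IS A STUB: in 3-D only the INEQUALITY
`ν∫‖∇u‖²dμ ≤ ∫(u,f)dμ` is known for stationary statistical solutions (FMRT IV (1.31),
`Torus.IsStationaryStatisticalSolution.energy_le`), energy equality for Leray–Hopf solutions is known
only under Lions–Shinbrot-type integrability, and the relaxed class of S1 is larger than FMRT's (one
global inequality, no dynamics): a relaxed statistic with a genuine leak would refute S4 — and with it
the pinned line, since the certificate's energy channel `θ₁ ≤ 0` cannot price a leak (weak duality
gives `ε₀ ≤ ε(μ) + 2θ₁L(μ) ≤ ε(μ)`). No construction of a leaky stationary statistic at positive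
viscosity with smooth steady forcing is known (Buckmaster–Vicol / Albritton–Brué–Colombo
non-uniqueness: infinite mean enstrophy resp. singular forcing — outside the class). Sources:
FoiasManleyRosaTemam2001 IV (1.31)–(1.34); arXiv:1709.10033 (BV2019); arXiv:2112.03116 (ABC2022);
tree `Torus.IsSteadyWeakSolution.energy_eq'`, `Torus.ensembleDissipation_le_of_isStationary`.
Size L–XL (open; independent of S3). -/
theorem stub_quietKolmogorovStatisticsSmallLeak :
    ∀ f : UnitAddTorus (Fin 3) → EuclideanSpace ℝ (Fin 3),
      f = ⇑(Torus.stokesMode (Pi.single 1 1 : Fin 3 → ℤ) (EuclideanSpace.single (0 : Fin 3) (1 : ℝ)) false) →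
      ∀ η : ℝ, 0 < η →
      ∃ (ε₂ ν₂ : ℝ), 0 < ε₂ ∧ 0 < ν₂ ∧
        ∀ ν : ℝ, 0 < ν → ν < ν₂ →
        ∀ μ : Measure (Torus.energySpace (Fin 3)),
          IsProbabilityMeasure μ →
          (∀ᵐ u ∂μ, ‖u‖ ^ 2 ≤ 16 * (∫ x, ‖f x‖ ^ 2) / ν ^ 2) →
          Torus.ensembleEnstrophy μ < ⊤ →
          (∀ Φ : Torus.CylindricalTest (Fin 3),
            Integrable (fun u => Torus.nsGeneratorPairing ν f u (Φ.grad u)) μ ∧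
              ∫ u, Torus.nsGeneratorPairing ν f u (Φ.grad u) ∂μ = 0) →
          Integrable (fun u : Torus.energySpace (Fin 3) => Torus.pairing u.1 f) μ →
          ∫ u, (ν * (Torus.eGradNormSq u.1).toReal - Torus.pairing u.1 f) ∂μ ≤ 0 →
          Torus.ensembleDissipation ν μ < ε₂ →
          ∫ u, Torus.pairing u.1 f ∂μ ≤ Torus.ensembleDissipation ν μ + η := by
  sorry

/-! ## The pinned force and its tree-level bookkeeping (no `sorry`) -/

/-- The gravest Kolmogorov force on the unit `T³`: `x ↦ sin(2π x₁) e₀`, the Stokes eigenfield with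
frequency `e₁` and amplitude `e₀` (sine phase). -/
def kolmogorovForce : UnitAddTorus (Fin 3) → EuclideanSpace ℝ (Fin 3) :=
  ⇑(Torus.stokesMode (Pi.single 1 1 : Fin 3 → ℤ) (EuclideanSpace.single (0 : Fin 3) (1 : ℝ)) false)

/-- The first Stokes eigenvalue `λ₁ = 4π²|e₁|² = 4π²` of the unit `T³`, as attached to `f_K`. -/
def lam₁ : ℝ := Torus.stokesEigenvalue (Pi.single 1 1 : Fin 3 → ℤ)

theorem kolmogorovForce_def :
    kolmogorovForce =
      ⇑(Torus.stokesMode (Pi.single 1 1 : Fin 3 → ℤ) (EuclideanSpace.single (0 : Fin 3) (1 : ℝ)) false) :=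
  rfl

/-- The forcing frequency `e₁ ≠ 0`. -/
theorem freq_ne_zero : (Pi.single 1 1 : Fin 3 → ℤ) ≠ 0 := by
  intro h
  have h1 := congrFun h 1
  simp at h1

/-- Transversality `e₁ · e₀ = 0` (the mode is solenoidal). -/
theorem freq_inner_amp :
    ⟪Torus.latticeVec (Pi.single 1 1 : Fin 3 → ℤ), EuclideanSpace.single (0 : Fin 3) (1 : ℝ)⟫_ℝ = 0 := by
  rw [EuclideanSpace.inner_single_right, Torus.latticeVec_apply]
  simp

theorem kolmogorovForce_isSmooth : Torus.IsSmooth kolmogorovForce :=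
  Torus.isSmooth_stokesMode _ _ _

theorem kolmogorovForce_isDivFree : Torus.IsDivFree kolmogorovForce :=
  Torus.isDivFree_stokesMode freq_inner_amp false

theorem kolmogorovForce_hasZeroMean : Torus.HasZeroMean kolmogorovForce :=
  Torus.hasZeroMean_stokesMode freq_ne_zero _ _

/-- `f_K` is a Stokes eigenfield: `Δ f_K = −λ₁ f_K`. -/
theorem laplacian_kolmogorovForce (x : UnitAddTorus (Fin 3)) :
    Torus.laplacian kolmogorovForce x = (-lam₁) • kolmogorovForce x :=
  Torus.laplacian_stokesMode _ _ _ x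

theorem lam₁_pos : 0 < lam₁ :=
  Torus.stokesEigenvalue_pos freq_ne_zero

/-! ## Composition (no `sorry` outside the stubs) -/

/-- **Uniform loudness of the relaxed statistics of cube Kolmogorov flow** (K1 of the card, DERIVED
from S2 + S3 + S4): some `ε⋆, ν⋆ > 0` such that for `ν < ν⋆` every relaxed stationary statistic of
`NS_ν(f_K)` on the Leray ball dissipates at least `ε⋆`. Proof: take `(ε₁, ν₁, c, η)` from S3 and
`(ε₂, ν₂)` from S4 at this `η`; `ε⋆ = min ε₁ ε₂`, `ν⋆ = min (min ν₁ ν₂) (c²/((‖f_K‖²+1) λ₁ ε⋆))`. A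
relaxed `μ` with `ε(μ) < ε⋆` is anti-pumping by S2 (`‖f‖² + ∫I ≤ (‖f‖² νλ₁ ε(μ))^{1/2} ≤ c`) and
nearly honest by S4, so S3 gives `ε(μ) ≥ ε₁ ≥ ε⋆` — contradiction. -/
theorem kolmogorov_relaxed_loud :
    ∃ (ε₀ ν₀ : ℝ), 0 < ε₀ ∧ 0 < ν₀ ∧ ∀ ν : ℝ, 0 < ν → ν < ν₀ →
      ∀ μ : Measure (Torus.energySpace (Fin 3)),
        IsProbabilityMeasure μ →
        (∀ᵐ u ∂μ, ‖u‖ ^ 2 ≤ 16 * (∫ x, ‖kolmogorovForce x‖ ^ 2) / ν ^ 2) →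
        Torus.ensembleEnstrophy μ < ⊤ →
        (∀ Φ : Torus.CylindricalTest (Fin 3),
          Integrable (fun u => Torus.nsGeneratorPairing ν kolmogorovForce u (Φ.grad u)) μ ∧
            ∫ u, Torus.nsGeneratorPairing ν kolmogorovForce u (Φ.grad u) ∂μ = 0) →
        Integrable (fun u : Torus.energySpace (Fin 3) => Torus.pairing u.1 kolmogorovForce) μ →
        ∫ u, (ν * (Torus.eGradNormSq u.1).toReal - Torus.pairing u.1 kolmogorovForce) ∂μ ≤ 0 →
        ε₀ ≤ Torus.ensembleDissipation ν μ := by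
  obtain ⟨ε₁, ν₁, c, η, hε₁, hν₁, hc, hη, h3⟩ :=
    stub_noQuietHonestKolmogorovStatistics kolmogorovForce kolmogorovForce_def
  obtain ⟨ε₂, ν₂, hε₂, hν₂, h4⟩ :=
    stub_quietKolmogorovStatisticsSmallLeak kolmogorovForce kolmogorovForce_def η hη
  have hF2nn : 0 ≤ ∫ x, ‖kolmogorovForce x‖ ^ 2 := integral_nonneg fun x => by positivity
  have hl := lam₁_pos
  -- the floor `ε⋆ = min ε₁ ε₂` and the threshold `ν⋆`
  obtain ⟨εs, hεs_def⟩ : ∃ εs : ℝ, εs = min ε₁ ε₂ := ⟨_, rfl⟩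
  have hεs_pos : 0 < εs := by rw [hεs_def]; exact lt_min hε₁ hε₂
  have hεs₁ : εs ≤ ε₁ := by rw [hεs_def]; exact min_le_left _ _
  have hεs₂ : εs ≤ ε₂ := by rw [hεs_def]; exact min_le_right _ _
  have hden : 0 < ((∫ x, ‖kolmogorovForce x‖ ^ 2) + 1) * lam₁ * εs :=
    mul_pos (mul_pos (by linarith) hl) hεs_pos
  obtain ⟨νs, hνs_def⟩ : ∃ νs : ℝ,
      νs = min (min ν₁ ν₂) (c ^ 2 / (((∫ x, ‖kolmogorovForce x‖ ^ 2) + 1) * lam₁ * εs)) := ⟨_, rfl⟩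
  have hνs_pos : 0 < νs := by
    rw [hνs_def]
    exact lt_min (lt_min hν₁ hν₂) (div_pos (pow_pos hc 2) hden)
  refine ⟨εs, νs, hεs_pos, hνs_pos, fun ν hν hνlt μ hP hball hZ hL hI hE => ?_⟩
  rw [hνs_def] at hνlt
  have hν₁' : ν < ν₁ := lt_of_lt_of_le hνlt ((min_le_left _ _).trans (min_le_left _ _))
  have hν₂' : ν < ν₂ := lt_of_lt_of_le hνlt ((min_le_left _ _).trans (min_le_right _ _))
  have hνc : ν ≤ c ^ 2 / (((∫ x, ‖kolmogorovForce x‖ ^ 2) + 1) * lam₁ * εs) :=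
    hνlt.le.trans (min_le_right _ _)
  by_contra hquiet
  push Not at hquiet
  -- the dissipation of `μ` is nonnegative
  have hεμ_nn : 0 ≤ Torus.ensembleDissipation ν μ := by
    unfold Torus.ensembleDissipation
    exact mul_nonneg hν.le ENNReal.toReal_nonneg
  -- (S2) anti-pumping
  have hW := stub_eigenforceWorkBound ν lam₁ (16 * (∫ x, ‖kolmogorovForce x‖ ^ 2) / ν ^ 2)
    kolmogorovForce hν hl kolmogorovForce_isSmooth kolmogorovForce_isDivFree
    kolmogorovForce_hasZeroMean laplacian_kolmogorovForce μ hP hball hZ hL hI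
  have hprod : (∫ x, ‖kolmogorovForce x‖ ^ 2) * (ν * lam₁ * Torus.ensembleDissipation ν μ) ≤ c ^ 2 := by
    have h1 : ν * (((∫ x, ‖kolmogorovForce x‖ ^ 2) + 1) * lam₁ * εs) ≤ c ^ 2 := by
      have := (le_div_iff₀ hden).1 hνc
      linarith
    have hX : 0 ≤ ν * lam₁ * Torus.ensembleDissipation ν μ :=
      mul_nonneg (mul_nonneg hν.le hl.le) hεμ_nn
    have h2 : (∫ x, ‖kolmogorovForce x‖ ^ 2) * (ν * lam₁ * Torus.ensembleDissipation ν μ) ≤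
        ((∫ x, ‖kolmogorovForce x‖ ^ 2) + 1) * (ν * lam₁ * Torus.ensembleDissipation ν μ) := by
      nlinarith
    have hY : 0 ≤ ((∫ x, ‖kolmogorovForce x‖ ^ 2) + 1) * (ν * lam₁) :=
      mul_nonneg (by linarith) (mul_nonneg hν.le hl.le)
    have hle : Torus.ensembleDissipation ν μ ≤ εs := hquiet.le
    have h3' : ((∫ x, ‖kolmogorovForce x‖ ^ 2) + 1) * (ν * lam₁ * Torus.ensembleDissipation ν μ) ≤
        ((∫ x, ‖kolmogorovForce x‖ ^ 2) + 1) * (ν * lam₁ * εs) := by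
      have := mul_le_mul_of_nonneg_left hle hY
      nlinarith
    nlinarith
  have hsqrt : Real.sqrt ((∫ x, ‖kolmogorovForce x‖ ^ 2) * (ν * lam₁ * Torus.ensembleDissipation ν μ)) ≤ c := by
    calc Real.sqrt ((∫ x, ‖kolmogorovForce x‖ ^ 2) * (ν * lam₁ * Torus.ensembleDissipation ν μ))
          ≤ Real.sqrt (c ^ 2) := Real.sqrt_le_sqrt hprod
      _ = c := Real.sqrt_sq hc.le
  have hAP : (∫ x, ‖kolmogorovForce x‖ ^ 2) + ∫ u, Torus.inertialPairing u.1 kolmogorovForce ∂μ ≤ c :=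
    hW.trans hsqrt
  -- (S4) small leak
  have hleak := h4 ν hν hν₂' μ hP hball hZ hL hI hE (lt_of_lt_of_le hquiet hεs₂)
  -- (S3) loud
  have hloud := h3 ν hν hν₁' μ hP hball hZ hL hI hE hAP hleak
  linarith

/-- **TRANSFER TARGET `C⁺ = KolmogorovForceFloor`** (the crux with `f` instantiated at `f_K`):
`ε₀, ν₀ > 0` such that at every `ν < ν₀` a cylindrical multiplier `Φ₁` and a weight `θ₁ ≤ 0` certify
the floor `ε₀` on the finite-enstrophy part of the Leray ball of `f_K`. PROOF: `kolmogorov_relaxed_loud`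
feeds S1 with `ε = δ = ε⋆/2` at the radius `ρ = 16‖f_K‖²/ν²`. -/
theorem kolmogorovForceFloor :
    ∃ (ε₀ ν₀ : ℝ), 0 < ε₀ ∧ 0 < ν₀ ∧ ∀ ν : ℝ, 0 < ν → ν < ν₀ →
      ∃ (Φ₁ : Torus.CylindricalTest (Fin 3)) (θ₁ : ℝ), θ₁ ≤ 0 ∧
        ∀ u : Torus.energySpace (Fin 3),
          Torus.eGradNormSq u.1 ≠ ⊤ → ‖u‖ ^ 2 ≤ 16 * (∫ x, ‖kolmogorovForce x‖ ^ 2) / ν ^ 2 →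
            ε₀ ≤ ν * (Torus.eGradNormSq u.1).toReal +
                Torus.nsGeneratorPairing ν kolmogorovForce u (Φ₁.grad u) +
              2 * θ₁ * (Torus.pairing u.1 kolmogorovForce - ν * (Torus.eGradNormSq u.1).toReal) := by
  obtain ⟨εs, νs, hεs, hνs, hloud⟩ := kolmogorov_relaxed_loud
  refine ⟨εs / 2, νs, half_pos hεs, hνs, fun ν hν hνlt => ?_⟩
  have hρ : 0 ≤ 16 * (∫ x, ‖kolmogorovForce x‖ ^ 2) / ν ^ 2 := by
    have : 0 ≤ ∫ x, ‖kolmogorovForce x‖ ^ 2 := integral_nonneg fun x => by positivity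
    positivity
  refine stub_floorMinimax ν (16 * (∫ x, ‖kolmogorovForce x‖ ^ 2) / ν ^ 2) (εs / 2) (εs / 2)
    kolmogorovForce hν hρ (half_pos hεs) kolmogorovForce_isSmooth ?_
  intro μ hP hball hZ hL hI hE
  have := hloud ν hν hνlt μ hP hball hZ hL hI hE
  linarith

/-- **The composition `FloorCertificate_of`** — concludes the crux
`TaylorCertificates.FloorCertificate` BY NAME, takes no hypotheses; the only `sorry`s are inside the
four `stub_*`: the witness force is `f_K` (smooth, solenoidal, mean-zero by the tree's Stokes-mode
lemmas) and the certificates are those of `kolmogorovForceFloor`. -/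
theorem FloorCertificate_of :
    Summit.AnomalousDissipation.AnomalousDissipation.Theses.TaylorCertificates.FloorCertificate := by
  obtain ⟨ε₀, ν₀, hε₀, hν₀, hcert⟩ := kolmogorovForceFloor
  refine ⟨kolmogorovForce, kolmogorovForce_isSmooth, kolmogorovForce_isDivFree,
    kolmogorovForce_hasZeroMean, ε₀, ν₀, hε₀, hν₀, fun ν hν hνlt => ?_⟩
  obtain ⟨Φ₁, θ₁, hθ₁, hfloor⟩ := hcert ν hν hνlt
  exact ⟨Φ₁, θ₁, hθ₁, fun u hfin hball => hfloor u hfin hball⟩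

end

end Summit.AnomalousDissipation.AnomalousDissipation.Cruxes.FloorCertificate.MarchioroForceFloor
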